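import Literature.NumberTheory.Automorphic.OrbitalIntegralLocallyConstantChart
import Literature.NumberTheory.Rogawski1990.LocalTransferFundamentalLemma
import HarnessLib

/-!
# REALISATION of torus functions as regular orbital integrals, in chart coordinates (generic layer, non-archimedean)
(Harish-Chandra (1970), Part I §3; Rogawski (1990), §4.3 (4.3.1) p. 43, §4.9 p. 54; Langlands–Shelstad (1987), §1.3 «transfer away from the singular set»)

Topic `NumberTheory/Automorphic`; namespace `Literature.NumberTheory.Automorphic`. THEOREMS ONLY (no definition, no instance, no notation, no named fact, no `sorry`).
Cell `pub/hodgecm-mathlib`, programme P3a, road «N6-ns» (letter N6, #102, non-split half), brick **N6ns-reg-(iv) H-SIDE SURJECTIVITY** (LEAD F0P3a-plan (g9)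
T8-15 (D), T8-17 (B); census `F0/P3a/F0P3a-p08/g12/CENSUS-N6ns-reg-iv-Hside.F0P3a-p08g12.md` 101dd0368ec3b74e). GENERIC locally-compact-group layer in the frame of
★ `OrbitalIntegralLocallyConstantChart` (F0P3a-p03, «N6ns-reg-(ii)»): `T ≤ G` closed, a canonical orbital measure family `m` for `(P, ν)` (★ `OrbitalMeasureFamily.IsCanonical`),
slice data `S Ω V ⊆ G` with the saturation (SAT) `∀ t ∈ V, ∀ x, x t x⁻¹ ∈ Ω → x ∈ S·T` (★ `mem_mul_of_conj_mem_image_chart`); the unitary ∕ CM dress is a separate file.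

WHY. The non-archimedean GLUE (★ `Rogawski1990/LocalTransferGlue.exists_transfer_of_cover` :155) reduces the N6 letter at a non-split place to a per-chart obligation
`hloc`: for `ψ ∈ C_c^∞(G′_v)` supported in a regular chart, produce `ψH ∈ C_c^∞(H_v)` whose STABLE orbital integral (★ `stableOrbitalIntegralRel`) is the PRESCRIBED class
function `γH ↦ Σ_c Δ‴_v(γH, c) O_c(ψ)` (★ `IsDeltaTransferRel` :202). This file is the H-side: (iv-a) every locally constant torus function `g` supported in a small box IS
`b ↦ Φ([τ b], fH)` for an EXPLICIT `fH ∈ C_c^∞` built on the chart (REALISATION — the easy direction of Harish-Chandra's «orbital integrals of `C_c^∞` functions supported in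
a regular chart are the `C_c^∞` functions of the torus parameter»), (iv-b) `fH`'s orbital integrals VANISH at classes missing the chart, (iv-c) the STABLE sum collapses to one
class. (iv-d) — `Δ‴_v` is a stable class function of `γH` — is ★ B-p10 `FinExplicitTransferFactorStableInvariance`.

* §1 POSITIVITY: `quotientMeasure_pos_of_isOpen` (the canonical quotient measure ★ `quotientMeasure` is positive on non-empty open sets: invariant, regular, non-zero,
  and `G ↷ G ⧸ T` is minimal — Mathlib `measure_isOpen_pos_of_smulInvariant_of_ne_zero`); `measurableSet_image_mk_of_isCompact`; **`quotientMeasure_image_mk_pos_of_sat`**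
  (under (SAT) at one `t` with one conjugate in the OPEN `Ω`, the slice image `π(S)` has POSITIVE measure: `{x | x t x⁻¹ ∈ Ω}` is open, non-empty, `⊆ S·T`).
* §2 THE CHART FUNCTION: **`exists_isLocSmooth_eq_on_chart`** — for `e : OpenPartialHomeomorph (A × B) G` with `e (a, b) = s a * τ b * (s a)⁻¹` on its source, `K ⊆ A` and
  `B₁ ⊆ B` compact OPEN with `K ×ˢ B₁ ⊆ e.source`, and `g : B → ℂ` locally constant: `F := 1_{e(K × B₁)} · (g ∘ pr₂ ∘ e⁻¹)` is `IsLocSmooth` (★ `Rogawski1990.IsLocSmooth`: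
  locally constant, compact support), vanishes off the clopen compact `Ω = e(K × B₁)`, and `F (s a * τ b * (s a)⁻¹) = g b` on `K × B₁`.
* §3 REALISATION: **`IsCanonical.exists_isLocSmooth_classOrbitalIntegral_mk_eq_of_chart`** — with the canonical family `m`, `hreg : ∀ b ∈ B₁, P (τ b) ∧ Z(τ b) = T`, (SAT) for
  `S = s(K)`, `Ω = e(K × B₁)`: `∃ fH, IsLocSmooth fH ∧ (∀ y ∉ Ω, fH y = 0) ∧ ∀ b ∈ B₁, Φ([τ b], fH; m) = g b` (§2 at `vol⁻¹ • g`, `vol = (ν∕ρ)(π(s K)) ∈ (0, ∞)` by §1,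
  then ★ «vol × g» `IsCanonical.classOrbitalIntegral_mk_eq_measureReal_smul_of_forall_conj_eq`).
* §4 VANISHING and the STABLE SUM: `classOrbitalIntegral_mk_eq_zero_of_forall_conj_notMem_tsupport` (★ `orbitalIntegral_eq_zero_of_forall_notMem_tsupport` at any
  representative); `stableOrbitalIntegralRel_eq_zero_of_forall`, **`stableOrbitalIntegralRel_eq_classOrbitalIntegral_of_forall_ne`** (the `∑ᶠ` of ★ `stableOrbitalIntegralRel` over the
  stable family of `a` collapses to the one class with a non-zero term — the «unique box point» `hsep_st` of the census is discharged by the dress).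
HONEST LABEL: HC_CM is proved only modulo the printed citations until rung 0 closes; this file proves no letter.

## References
* [HarishChandra1970] Harish-Chandra (notes by G. van Dijk), *Harmonic Analysis on Reductive p-adic Groups*, LNM 162 (1970), Part I §3.
* [Rogawski1990] J. D. Rogawski, *Automorphic Representations of Unitary Groups in Three Variables*, Ann. of Math. Stud. 123 (1990), §4.3 (4.3.1) p. 43; §4.9 p. 54.
* [LanglandsShelstad1987] R. P. Langlands, D. Shelstad, *On the definition of transfer factors*, Math. Ann. 278 (1987), §1.3.
* [DeitmarEchterhoff2014] A. Deitmar, S. Echterhoff, *Principles of Harmonic Analysis*, 2nd ed. (2014), Thm. 1.5.3.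
-/

set_option autoImplicit false

noncomputable section

open MeasureTheory Measure Set Filter Topology
open Literature.MeasureTheory.Group Literature.NumberTheory.Rogawski1990
open scoped ENNReal NNReal Pointwise

namespace Literature.NumberTheory.Automorphic

/-! ## §1 Positivity of the canonical quotient measure on open sets and on saturated slice images -/

section Positivity

variable {G : Type*} [Group G] [TopologicalSpace G] [IsTopologicalGroup G] [LocallyCompactSpace G] [SecondCountableTopology G]
  [T2Space G] [MeasurableSpace G] [BorelSpace G]
  (T : Subgroup G) (hTc : IsClosed (T : Set G)) [MeasurableSpace (G ⧸ T)] [BorelSpace (G ⧸ T)]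
  (ρ : Measure ↥T) [IsHaarMeasure ρ] [ρ.IsInvInvariant] (ν : Measure G) [IsHaarMeasure ν] [ν.IsMulRightInvariant]

/-- **The canonical quotient measure is positive on non-empty open sets** (it is `G`-invariant, regular and non-zero ★ `quotientMeasure_ne_zero`, and the action of `G`
on `G ⧸ T` is transitive hence minimal; Mathlib `measure_isOpen_pos_of_smulInvariant_of_ne_zero`). [cite: DeitmarEchterhoff2014, Thm. 1.5.3] -/
theorem quotientMeasure_pos_of_isOpen {W : Set (G ⧸ T)} (hW : IsOpen W) (hne : W.Nonempty) : 0 < quotientMeasure T ρ hTc ν W := by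
  haveI : IsClosed (T : Set G) := hTc
  exact measure_isOpen_pos_of_smulInvariant_of_ne_zero G (quotientMeasure_ne_zero T ρ hTc ν) hW hne

omit [LocallyCompactSpace G] [SecondCountableTopology G] [T2Space G] [MeasurableSpace G] [BorelSpace G] in
include hTc in
/-- `π(S)` is measurable for compact `S` and closed `T`: its preimage `S · T` is closed (compact times closed), and `π` is a quotient map. [cite: DeitmarEchterhoff2014, Thm. 1.5.3] -/
theorem measurableSet_image_mk_of_isCompact {S : Set G} (hS : IsCompact S) : MeasurableSet (QuotientGroup.mk '' S : Set (G ⧸ T)) := by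
  refine IsClosed.measurableSet ?_
  rw [← (QuotientGroup.isQuotientMap_mk T).isClosed_preimage, QuotientGroup.preimage_image_mk_eq_mul]
  exact hTc.mul_left_of_isCompact hS

/-- **A saturated slice image has positive measure**: if `Ω` is open, `x₀ t x₀⁻¹ ∈ Ω` for some `x₀`, and every `x` with `x t x⁻¹ ∈ Ω` lies in `S · T` ((SAT) at `t`), then
`0 < (ν∕ρ)(π(S))` — the open non-empty `{x ∣ x t x⁻¹ ∈ Ω}` maps into `π(S)` under the open map `π`. [cite: HarishChandra1970, Part I §3] [cite: DeitmarEchterhoff2014, Thm. 1.5.3] -/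
theorem quotientMeasure_image_mk_pos_of_sat {S Ω : Set G} (hΩ : IsOpen Ω) {t : G} (hsat : ∀ x : G, x * t * x⁻¹ ∈ Ω → x ∈ S * (T : Set G))
    {x₀ : G} (hx₀ : x₀ * t * x₀⁻¹ ∈ Ω) : 0 < quotientMeasure T ρ hTc ν (QuotientGroup.mk '' S) := by
  have hUo : IsOpen {x : G | x * t * x⁻¹ ∈ Ω} := hΩ.preimage ((continuous_id.mul continuous_const).mul continuous_id.inv)
  have hsub : (QuotientGroup.mk '' {x : G | x * t * x⁻¹ ∈ Ω} : Set (G ⧸ T)) ⊆ QuotientGroup.mk '' S := by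
    rintro _ ⟨x, hx, rfl⟩
    obtain ⟨s, hs, τ, hτ, rfl⟩ := Set.mem_mul.1 (hsat x hx)
    exact ⟨s, hs, QuotientGroup.eq.2 (by rw [inv_mul_cancel_left]; exact hτ)⟩
  exact lt_of_lt_of_le (quotientMeasure_pos_of_isOpen T hTc ρ ν (QuotientGroup.isOpenMap_coe _ hUo) ⟨_, x₀, hx₀, rfl⟩) (measure_mono hsub)

end Positivity

/-! ## §2 The chart function: locally constant, compactly supported, prescribed along the slice -/

section ChartFunction

variable {A B G : Type*} [TopologicalSpace A] [TopologicalSpace B] [TopologicalSpace G] [T2Space G] [Group G]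

/-- **The chart function.** For an open partial homeomorphism `e : A × B → G` with `e (a, b) = s a * τ b * (s a)⁻¹` on its source, compact open `K ⊆ A`, `B₁ ⊆ B` with
`K × B₁ ⊆ e.source`, and `g : B → ℂ` locally constant, there is `F : G → ℂ`, locally constant with compact support (`IsLocSmooth`), vanishing off the compact open
`Ω = e(K × B₁)`, with `F (s a · τ b · (s a)⁻¹) = g b` for `a ∈ K`, `b ∈ B₁` — namely `F = 1_Ω · (g ∘ pr₂ ∘ e⁻¹)`. [cite: HarishChandra1970, Part I §3] -/
theorem exists_isLocSmooth_eq_on_chart (e : OpenPartialHomeomorph (A × B) G) (s : A → G) (τ : B → G)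
    (he : ∀ p ∈ e.source, e p = s p.1 * τ p.2 * (s p.1)⁻¹) {K : Set A} (hKc : IsCompact K) (hKo : IsOpen K) {B₁ : Set B} (hB₁c : IsCompact B₁)
    (hB₁o : IsOpen B₁) (hKB : K ×ˢ B₁ ⊆ e.source) (g : B → ℂ) (hg : IsLocallyConstant g) :
    ∃ F : G → ℂ, Rogawski1990.IsLocSmooth F ∧ (∀ y ∉ e '' (K ×ˢ B₁), F y = 0) ∧ ∀ a ∈ K, ∀ b ∈ B₁, F (s a * τ b * (s a)⁻¹) = g b := by
  classical
  set Ω : Set G := e '' (K ×ˢ B₁) with hΩ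
  have hΩo : IsOpen Ω := e.isOpen_image_of_subset_source (hKo.prod hB₁o) hKB
  have hΩc : IsCompact Ω := (hKc.prod hB₁c).image_of_continuousOn (e.continuousOn.mono hKB)
  have hΩt : Ω ⊆ e.target := fun y ⟨p, hp, hpy⟩ => hpy ▸ e.map_source (hKB hp)
  refine ⟨Ω.indicator fun y => g (e.symm y).2, ⟨?_, ?_⟩, fun y hy => Set.indicator_of_notMem hy _, fun a ha b hb => ?_⟩
  · -- locally constant: on the clopen `Ω` it is `g ∘ pr₂ ∘ e.symm` (continuous there), off `Ω` it is `0`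
    refine (IsLocallyConstant.iff_eventually_eq _).2 fun y => ?_
    by_cases hy : y ∈ Ω
    · have hcont : ContinuousAt (fun y' => (e.symm y').2) y := (e.continuousAt_symm (hΩt hy)).snd
      have hgev : ∀ᶠ y' in 𝓝 y, g (e.symm y').2 = g (e.symm y).2 :=
        hcont.eventually (hg.eventually_eq (e.symm y).2)
      filter_upwards [hΩo.mem_nhds hy, hgev] with y' hy' hgy'
      rw [Set.indicator_of_mem hy', Set.indicator_of_mem hy, hgy']
    · filter_upwards [hΩc.isClosed.isOpen_compl.mem_nhds hy] with y' hy'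
      rw [Set.indicator_of_notMem hy', Set.indicator_of_notMem hy]
  · exact HasCompactSupport.intro hΩc fun y hy => Set.indicator_of_notMem hy _
  · have hp : (a, b) ∈ e.source := hKB (Set.mk_mem_prod ha hb)
    have hy : s a * τ b * (s a)⁻¹ = e (a, b) := (he (a, b) hp).symm
    have hmem : e (a, b) ∈ Ω := ⟨(a, b), Set.mk_mem_prod ha hb, rfl⟩
    rw [hy, Set.indicator_of_mem hmem, e.left_inv hp]

end ChartFunction

/-! ## §3 REALISATION: every locally constant torus function on a small box is a regular orbital integral -/

section Realisation

variable {G : Type*} [Group G] [TopologicalSpace G] [IsTopologicalGroup G] [LocallyCompactSpace G] [SecondCountableTopology G]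
  [T2Space G] [MeasurableSpace G] [BorelSpace G]
  [∀ γ : G, MeasurableSpace (G ⧸ Subgroup.centralizer ({γ} : Set G))]
  [∀ γ : G, BorelSpace (G ⧸ Subgroup.centralizer ({γ} : Set G))]
  {A B : Type*} [TopologicalSpace A] [TopologicalSpace B]

/-- **REALISATION (H-side surjectivity, easy direction).** Let `m` be canonical for `(P, ν)` (★ `OrbitalMeasureFamily.IsCanonical`), `T ≤ G` closed with its normalised Haar
measure `ρ` (`ρ(compactCore T) = 1`), `e : A × B → G` an open partial homeomorphism with `e (a, b) = s a * τ b * (s a)⁻¹` on its source, `K ∋ a₀` compact open, `B₁` compact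
open, `K × B₁ ⊆ e.source`, every `τ b` (`b ∈ B₁`) a `P`-point with centraliser `T` (`hreg`), and (SAT): `x (τ b) x⁻¹ ∈ e(K × B₁) ⇒ x ∈ s(K) · T`. Then EVERY locally constant
`g : B → ℂ` is realised: `∃ fH ∈ C_c^∞(G)`, zero off `e(K × B₁)`, with `Φ([τ b], fH; m) = g b` for all `b ∈ B₁` — take `fH := 1_Ω · vol⁻¹ • (g ∘ pr₂ ∘ e⁻¹)`,
`vol = (ν∕ρ)(π(s K)) ∈ (0, ∞)` (§1), and apply ★ «vol × g» `IsCanonical.classOrbitalIntegral_mk_eq_measureReal_smul_of_forall_conj_eq`.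
[cite: HarishChandra1970, Part I §3] [cite: Rogawski1990, §4.3 (4.3.1) p. 43; §4.9 p. 54] [cite: LanglandsShelstad1987, §1.3] -/
theorem OrbitalMeasureFamily.IsCanonical.exists_isLocSmooth_classOrbitalIntegral_mk_eq_of_chart
    {P : G → Prop} (hP : ∀ g x : G, P g → P (x * g * x⁻¹)) {ν : Measure G} [IsHaarMeasure ν] [ν.IsMulRightInvariant]
    {m : OrbitalMeasureFamily G} (hm : m.IsCanonical P ν)
    (T : Subgroup G) (hTc : IsClosed (T : Set G)) [MeasurableSpace (G ⧸ T)] [BorelSpace (G ⧸ T)]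
    (ρ : Measure ↥T) [IsHaarMeasure ρ] [ρ.IsInvInvariant] (hρ : ρ (compactCore ↥T) = 1)
    (e : OpenPartialHomeomorph (A × B) G) (s : A → G) (hs : Continuous s) (τ : B → G)
    (he : ∀ p ∈ e.source, e p = s p.1 * τ p.2 * (s p.1)⁻¹) {K : Set A} (hKc : IsCompact K) (hKo : IsOpen K) {a₀ : A} (ha₀ : a₀ ∈ K)
    {B₁ : Set B} (hB₁c : IsCompact B₁) (hB₁o : IsOpen B₁) (hKB : K ×ˢ B₁ ⊆ e.source)
    (hreg : ∀ b ∈ B₁, P (τ b) ∧ Subgroup.centralizer ({τ b} : Set G) = T)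
    (hsat : ∀ b ∈ B₁, ∀ x : G, x * τ b * x⁻¹ ∈ e '' (K ×ˢ B₁) → x ∈ s '' K * (T : Set G))
    (g : B → ℂ) (hg : IsLocallyConstant g) :
    ∃ fH : G → ℂ, Rogawski1990.IsLocSmooth fH ∧ (∀ y ∉ e '' (K ×ˢ B₁), fH y = 0) ∧
      ∀ b ∈ B₁, classOrbitalIntegral m fH (ConjClasses.mk (τ b)) = g b := by
  -- the slice volume `vol ∈ (0, ∞)`
  set vol : ℝ := (quotientMeasure T ρ hTc ν).real (QuotientGroup.mk '' (s '' K) : Set (G ⧸ T)) with hvol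
  have hΩo : IsOpen (e '' (K ×ˢ B₁)) := e.isOpen_image_of_subset_source (hKo.prod hB₁o) hKB
  have hSc : IsCompact (s '' K) := hKc.image hs
  have hSm : MeasurableSet (QuotientGroup.mk '' (s '' K) : Set (G ⧸ T)) := measurableSet_image_mk_of_isCompact T hTc hSc
  have hvol_pos : ∀ b ∈ B₁, 0 < vol := fun b hb => by
    have hx₀ : s a₀ * τ b * (s a₀)⁻¹ ∈ e '' (K ×ˢ B₁) :=
      ⟨(a₀, b), Set.mk_mem_prod ha₀ hb, he (a₀, b) (hKB (Set.mk_mem_prod ha₀ hb))⟩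
    have hpos := quotientMeasure_image_mk_pos_of_sat T hTc ρ ν hΩo (hsat b hb) hx₀
    have hfin : quotientMeasure T ρ hTc ν (QuotientGroup.mk '' (s '' K)) < ∞ :=
      (hSc.image (QuotientGroup.continuous_mk (N := T))).measure_lt_top
    exact ENNReal.toReal_pos hpos.ne' hfin.ne
  -- the chart function for `vol⁻¹ • g`
  obtain ⟨F, hF, hF0, hFv⟩ := exists_isLocSmooth_eq_on_chart e s τ he hKc hKo hB₁c hB₁o hKB (fun b => (vol⁻¹ : ℂ) * g b)
    (hg.comp fun z => (vol⁻¹ : ℂ) * z)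
  refine ⟨F, hF, hF0, fun b hb => ?_⟩
  have hTt : ∀ τ' ∈ T, τ' * τ b = τ b * τ' := fun τ' hτ' => by
    rw [← (hreg b hb).2] at hτ'
    exact Subgroup.mem_centralizer_singleton_iff.1 hτ'
  rw [hm.classOrbitalIntegral_mk_eq_measureReal_smul_of_forall_conj_eq hP T hTc ρ hρ (s '' K) (e '' (K ×ˢ B₁)) (τ '' B₁)
    (fun t ⟨b', hb', ht⟩ => ht ▸ hreg b' hb') (fun t ⟨b', hb', ht⟩ x hx => hsat b' hb' x (ht ▸ hx)) hF0 ⟨b, hb, rfl⟩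
    (c := (vol⁻¹ : ℂ) * g b) (fun s' ⟨a, ha, hs'⟩ => hs' ▸ hFv a ha b hb) hSm]
  rw [← hvol, Complex.real_smul, ← mul_assoc, ← Complex.ofReal_inv, ← Complex.ofReal_mul, mul_inv_cancel₀ (hvol_pos b hb).ne', Complex.ofReal_one, one_mul]

end Realisation

/-! ## §4 Vanishing off the chart and the collapse of the stable sum -/

section Stable

variable {G : Type*} [Group G]

/-- The chosen representative of the class of `t` is conjugate to `t`. [folklore] -/
private theorem exists_conj_eq_out_mk (t : G) : ∃ y : G, y * t * y⁻¹ = Quotient.out (ConjClasses.mk t) := by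
  have h : ConjClasses.mk (Quotient.out (ConjClasses.mk t)) = ConjClasses.mk t := Quotient.out_eq _
  obtain ⟨c, hc⟩ := isConj_iff.1 (ConjClasses.mk_eq_mk_iff_isConj.1 h.symm)
  exact ⟨c, hc⟩

/-- **VANISHING OFF THE CHART**: if no conjugate of `t` meets `tsupport f`, then `Φ([t], f; m) = 0` (★ `orbitalIntegral_eq_zero_of_forall_notMem_tsupport` at the chosen
representative, itself a conjugate of `t`). [cite: Rogawski1990, §4.9 p. 54] -/
theorem classOrbitalIntegral_mk_eq_zero_of_forall_conj_notMem_tsupport [TopologicalSpace G]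
    [∀ γ : G, MeasurableSpace (G ⧸ Subgroup.centralizer ({γ} : Set G))] (m : OrbitalMeasureFamily G) {f : G → ℂ} {t : G}
    (h : ∀ x : G, x * t * x⁻¹ ∉ tsupport f) : classOrbitalIntegral m f (ConjClasses.mk t) = 0 := by
  obtain ⟨y, hy⟩ := exists_conj_eq_out_mk t
  rw [classOrbitalIntegral_eq]
  refine orbitalIntegral_eq_zero_of_forall_notMem_tsupport _ _ fun x => ?_
  rw [← hy, show x * (y * t * y⁻¹) * x⁻¹ = (x * y) * t * (x * y)⁻¹ by group]
  exact h (x * y)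

/-- **THE STABLE SUM IS ZERO** when every class of the stable family of `a` has vanishing orbital integral. [cite: Rogawski1990, §4.1 (4.1.1) p. 39] -/
theorem stableOrbitalIntegralRel_eq_zero_of_forall [∀ γ : G, MeasurableSpace (G ⧸ Subgroup.centralizer ({γ} : Set G))]
    (st : G → G → Prop) (m : OrbitalMeasureFamily G) (f : G → ℂ) (a : G)
    (h : ∀ c : ConjClasses G, st a (Quotient.out c) → classOrbitalIntegral m f c = 0) : stableOrbitalIntegralRel st m f a = 0 := by
  rw [stableOrbitalIntegralRel_def, finsum_mem_def]
  refine finsum_eq_zero_of_forall_eq_zero fun c => ?_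
  by_cases hc : c ∈ {c : ConjClasses G | st a (Quotient.out c)}
  · rw [Set.indicator_of_mem hc]; exact h c hc
  · rw [Set.indicator_of_notMem hc]

/-- **THE STABLE SUM COLLAPSES TO ONE CLASS**: if `c₀` lies in the stable family of `a` and every OTHER class of that family has vanishing orbital integral (e.g. by
`classOrbitalIntegral_mk_eq_zero_of_forall_conj_notMem_tsupport`: it misses the chart), then `Φ^st(a, f) = Φ(c₀, f)`. [cite: Rogawski1990, §4.1 (4.1.1) p. 39; §4.3 (4.3.1) p. 43] -/
theorem stableOrbitalIntegralRel_eq_classOrbitalIntegral_of_forall_ne [∀ γ : G, MeasurableSpace (G ⧸ Subgroup.centralizer ({γ} : Set G))]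
    (st : G → G → Prop) (m : OrbitalMeasureFamily G) (f : G → ℂ) (a : G)
    (c₀ : ConjClasses G) (hc₀ : st a (Quotient.out c₀))
    (h : ∀ c : ConjClasses G, st a (Quotient.out c) → c ≠ c₀ → classOrbitalIntegral m f c = 0) :
    stableOrbitalIntegralRel st m f a = classOrbitalIntegral m f c₀ := by
  rw [stableOrbitalIntegralRel_def, finsum_mem_def,
    finsum_eq_single (fun c => Set.indicator {c : ConjClasses G | st a (Quotient.out c)} (fun c => classOrbitalIntegral m f c) c) c₀ ?_]
  · exact Set.indicator_of_mem (show c₀ ∈ {c : ConjClasses G | st a (Quotient.out c)} from hc₀) _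
  · intro c hne
    by_cases hc : c ∈ {c : ConjClasses G | st a (Quotient.out c)}
    · rw [Set.indicator_of_mem hc]; exact h c hc hne
    · rw [Set.indicator_of_notMem hc]

end Stable

end Literature.NumberTheory.Automorphic

end
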